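import Mathlib.CategoryTheory.Groupoid
import Mathlib.CategoryTheory.Functor.FullyFaithful
import Mathlib.CategoryTheory.NatIso
import Mathlib.Data.Set.Image
import Mathlib.Logic.Function.Basic
import Literature.IUT.LogThetaLattice.PrimeStripFrame
import HarnessLib

/-!
# [IUTchIII] Definition 1.1 (iii) and Proposition 1.2 (i), (x): log-links between `F`-prime-strips

Mochizuki, *Inter-universal Teichmüller Theory III*, kurims manuscript (May 2020), §1
[cite: Mochizuki2012, III Def 1.1 (iii) pp.26–27; Rmk 1.1.2 (i) p.29; Prop 1.2 (i) p.31, (x) p.34]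
(D-0012 claim key, status disputed; typed over the interface `StripFrame`, nothing asserted).

Printed text.
* Def 1.1 (iii) pp.26–27: "Write `log(†F) := {log(†F_v)}_{v∈V̲}` for the `F`-prime-strip determined by
  the data `log(†F_v)` constructed in (i), (ii) … We shall denote by `†F --log--> log(†F)` the
  collection of diagrams … and refer to this relationship between `†F` and `log(†F)` as the
  *tautological log-link* associated to `†F`. If `log(†F) ⥲ ‡F` is any [poly-]isomorphism of
  `F`-prime-strips, then we shall write `†F --log--> ‡F` for the diagram obtained by post-composing
  the tautological log-link associated to `†F` with the given [poly-]isomorphism `log(†F) ⥲ ‡F` and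
  refer to this relationship between `†F` and `‡F` as a *log-link* from `†F` to `‡F`; when the given
  [poly-]isomorphism `log(†F) ⥲ ‡F` is the full poly-isomorphism, then we shall refer to the resulting
  log-link as the *full log-link* from `†F` to `‡F`."
* Rmk 1.1.2 (i) p.29: the tautological log-link "satisfies the property that there is a tautological
  identification between the `†Π_v`'s that appear in the data that gives rise to the domain … and …
  the codomain"; for the full log-link the two are "related … by means of a full poly-isomorphism
  `†Π_v ⥲ ‡Π_v`".
* Prop 1.2 (i) p.31 (Coricity of Associated `D`-Prime-Strips): "The log-link `†F --log--> ‡F`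
  induces [poly-]isomorphisms `†D ⥲ ‡D`; `†D^⊢ ⥲ ‡D^⊢` between the associated `D`- and
  `D^⊢`-prime-strips. In particular, … induces a [poly-]isomorphism `Ψ_cns(†D) ⥲ Ψ_cns(‡D)` …"
* Prop 1.2 (x) p.34 (Frobenius-picture): "Let `{ⁿF}_{n∈ℤ}` be a collection of distinct
  `F`-prime-strips … Then the full log-links `ⁿF --log--> ⁿ⁺¹F`, for `n ∈ ℤ`, give rise to an
  infinite chain … of log-linked `F`-prime-strips which induces chains of full poly-isomorphisms
  `… ⥲ ⁿD ⥲ ⁿ⁺¹D ⥲ …` and `… ⥲ ⁿD^⊢ ⥲ ⁿ⁺¹D^⊢ ⥲ …` on the associated `D`- and `D^⊢`-prime-strips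
  [cf. (i)]. These chains may be represented symbolically as an oriented graph `Γ⃗` …" (the graph
  and its symmetry sentences: `FrobeniusPicture.lean` of this directory).

Typing. The local construction `†F_v ↦ log(†F_v)` of Def 1.1 (i), (ii) (the `p_v`-adic / archimedean
logarithm on the ind-topological monoids `Ψ_{†F_v}`) is [AbsTopIII] §3–§4 material; concretely it is
`LocalLogShells.lean`. At the level of §1's statements all that is used of it is: (a) it is a
functorial algorithm `log : F ⥤ F` on `F`-prime-strips, and (b) Rmk 1.1.2 (i): the `D`-prime-strip of
`log(†F)` is tautologically that of `†F` — recorded as the INTERFACE `LogStripData` (natural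
isomorphism `log ⋙ toD ≅ toD`). Over it `LogLink`, `LogLink.tautological`, `LogLink.full` are
DEFINITIONS transcribing Def 1.1 (iii) literally, and Prop 1.2 (i) becomes a CONSTRUCTION
(`LogLink.inducedD`, `inducedDv`) plus the THEOREMS `inducedD_full` / `inducedDv_full` (a full log-link
induces the FULL poly-isomorphisms — by [IUTchI] Cor 5.3 (ii), (iii), fields of the frame) and
`inducedD_tautological` (Rmk 1.1.2 (i)). Prop 1.2 (x) is `FrobeniusChain` with `FrobeniusChain.link`
and the induced full chains `inducedD_link_full`. NOT here: Prop 1.2 (vi)–(ix) (`BiCores.lean`),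
Prop 1.2 (ii)–(v) abstractly (their concrete content is `LocalLogShells.lean`; the ind-topological ring /
log-volume compatibilities are [AbsTopIII] §3–§5 statements, owners abc-iut-L4-t2/t3), Prop 1.3 / Def 1.4 /
Thm 1.5 (`HodgeTheaterLogLink.lean`). Deliberately NOT typed (expository Remark sub-items, L6 convention
C1; named here for the census): Rmk 1.1.1 (i) (iterated log-links are defined only on the local units),
Rmk 1.1.2 (ii) (archimedean analogue, "routine details"), Rmk 1.2.1 (i) (the "weight `N`" convention on
`Ψ^{gp}/Ψ^{μ_N}`) and (ii) (metrics on a complex archimedean field form an `ℝ_{>0}`-torsor, so angular vs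
radial log-volume compatibility is an invariance property), Rmk 1.2.2 (iii)–(vii) ("upper
semi-commutativity" of `Γ⃗`, Fig. 1.1), Rmk 1.2.4 (i)–(iii) (the log-wall, Fig. 1.2), Rmk 1.2.5.
-/

namespace Literature.IUT.LogThetaLattice

open CategoryTheory
open Literature.IUT.HodgeTheaters

universe u

variable {S : StripFrame.{u}}

/-! ### The construction `†F ↦ log(†F)` as an interface -/

/-- **IUTchIII:Def1.1(iii)** (kurims p.26) INTERFACE for Def 1.1 (i)–(iii): the functorial algorithm `†F ↦ log(†F)` on `F`-prime-strips
together with Rmk 1.1.2 (i)'s "tautological identification" of the `D`-prime-strips (the arithmetic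
fundamental groups `†Π_v`) of `†F` and `log(†F)`. (Concrete local content: `LocalLogShells.lean`;
the ind-topological packaging is [AbsTopIII] Def 3.1 / Prop 3.2, 4.2 — TODO-merge: abc-iut-L4-t2.) [claim: Mochizuki2012, status: disputed] -/
structure LogStripData (S : StripFrame.{u}) where
  /-- `†F ↦ log(†F) := {log(†F_v) := Ψ^∼_{†F_v}}_{v ∈ V̲}`, "the `F`-prime-strip determined by the data
  `log(†F_v)` constructed in (i), (ii)" [Def 1.1 (iii) p.26] -/
  log : S.F ⥤ S.F
  /-- Rmk 1.1.2 (i) p.29: "a tautological identification between the `†Π_v`'s that appear in the data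
  that gives rise to the domain [`{†Π_v ↷ Ψ_{†F_v}}`] and … the codomain [`{†Π_v ↷ Ψ_{log(†F_v)}}`]" —
  the associated `D`-prime-strips of `log(†F)` and `†F` coincide. -/
  logD : log ⋙ S.toD ≅ S.toD

namespace LogStripData

variable (L : LogStripData S)

/-- **IUTchIII:Rmk1.1.2(i)** (kurims p.29) The tautological identification `D(log(†F)) ≅ D(†F)` at one `F`-prime-strip. [claim: Mochizuki2012, status: disputed] -/
def logDIso (X : S.F) : S.toD.obj (L.log.obj X) ≅ S.toD.obj X := L.logD.app X

/-- **IUTchIII:Def1.1(i)** (kurims p.24) Def 1.1 (i), (ii): `log(†F_v)` "is, in fact, naturally isomorphic to" `†F_v` — hence an isomorphism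
of `F`-prime-strips `log(†F) ≅ †F` exists (here: by connectedness of the frame). The text insists one
NOT identify along it ("which we wish to think of as being related to `†F_v` via the above diagram"). [claim: Mochizuki2012, status: disputed] -/
theorem nonempty_iso_log (X : S.F) : Nonempty (L.log.obj X ≅ X) := S.iso_nonempty_F _ _

end LogStripData

/-! ### Def 1.1 (iii): log-links -/

/-- **IUTchIII:Def1.1(iii)** (kurims p.27) **Def 1.1 (iii): a log-link `†F --log--> ‡F`** from the `F`-prime-strip `X = †F` to `Y = ‡F`: the
tautological log-link `†F --log--> log(†F)` post-composed with a [poly-]isomorphism `log(†F) ⥲ ‡F`;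
as DATA it is that (nonempty) poly-isomorphism. [claim: Mochizuki2012, status: disputed] -/
structure LogLink (L : LogStripData S) (X Y : S.F) where
  /-- the [poly-]isomorphism `log(†F) ⥲ ‡F` -/
  polyIso : PolyIso (L.log.obj X) Y
  /-- a poly-morphism is a nonempty collection -/
  nonempty : polyIso.Nonempty

namespace LogLink

variable {L : LogStripData S} {X Y : S.F}

/-- **IUTchIII:Def1.1(iii)** (kurims p.27) **The tautological log-link** `†F --log--> log(†F)` (post-composition with the identity). [claim: Mochizuki2012, status: disputed] -/
def tautological (L : LogStripData S) (X : S.F) : LogLink L X (L.log.obj X) where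
  polyIso := PolyIso.single (Iso.refl _)
  nonempty := ⟨Iso.refl _, rfl⟩

/-- **IUTchIII:Def1.1(iii)** (kurims p.27) **The full log-link** from `†F` to `‡F`: post-composition with the full poly-isomorphism
`log(†F) ⥲ ‡F`. [claim: Mochizuki2012, status: disputed] -/
def full (L : LogStripData S) (X Y : S.F) : LogLink L X Y where
  polyIso := PolyIso.full _ _
  nonempty := S.full_nonempty_F _ _

/-- **IUTchIII:Def1.1(iii)** (kurims p.27) A log-link given by a single isomorphism `log(†F) ⥲ ‡F`. [claim: Mochizuki2012, status: disputed] -/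
def ofIso (L : LogStripData S) {X Y : S.F} (φ : L.log.obj X ≅ Y) : LogLink L X Y where
  polyIso := PolyIso.single φ
  nonempty := ⟨φ, rfl⟩

/-- **IUTchIII:Def1.1(iii)** (kurims p.27) A log-link is *full* when its poly-isomorphism is the full one. [claim: Mochizuki2012, status: disputed] -/
def IsFull (ℓ : LogLink L X Y) : Prop := ℓ.polyIso = PolyIso.full _ _

/-- **IUTchIII:Def1.1(iii)** (kurims p.27) The full log-link is full. [claim: Mochizuki2012, status: disputed] -/
theorem isFull_full (L : LogStripData S) (X Y : S.F) : (full L X Y).IsFull := rfl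

/-- **IUTchIII:Def1.1(iii)** (kurims p.27) Two log-links with the same poly-isomorphism are equal. [claim: Mochizuki2012, status: disputed] -/
@[ext] theorem ext {ℓ ℓ' : LogLink L X Y} (h : ℓ.polyIso = ℓ'.polyIso) : ℓ = ℓ' := by
  cases ℓ; cases ℓ'; cases h; rfl

/-- **IUTchIII:Def1.1(iii)** (kurims p.27) A full log-link IS the full log-link. [claim: Mochizuki2012, status: disputed] -/
theorem eq_full_of_isFull {ℓ : LogLink L X Y} (h : ℓ.IsFull) : ℓ = full L X Y := ext h

/-! ### Prop 1.2 (i): coricity of the associated `D`- and `D^⊢`-prime-strips -/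

/-- **IUTchIII:Prop1.2(i)** (kurims p.31) **Prop 1.2 (i), construction**: the poly-isomorphism `†D ⥲ ‡D` of associated `D`-prime-strips
induced by a log-link `†F --log--> ‡F` — each constituent `φ : log(†F) ⥲ ‡F` gives
`D(†F) = D(log †F) ⥲ D(‡F)` (Rmk 1.1.2 (i) then functoriality of `F ↦ D`). [claim: Mochizuki2012, status: disputed] -/
def inducedD (ℓ : LogLink L X Y) : PolyIso (S.toD.obj X) (S.toD.obj Y) :=
  (fun φ => (L.logDIso X).symm ≪≫ S.toD.mapIso φ) '' ℓ.polyIso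

/-- **IUTchIII:Prop1.2(i)** (kurims p.31) The induced poly-isomorphism of `D`-prime-strips is nonempty. [claim: Mochizuki2012, status: disputed] -/
theorem inducedD_nonempty (ℓ : LogLink L X Y) : ℓ.inducedD.Nonempty :=
  ℓ.nonempty.image _

/-- **IUTchIII:Prop1.2(i)** (kurims p.31) Membership in the induced poly-isomorphism. [claim: Mochizuki2012, status: disputed] -/
theorem mem_inducedD (ℓ : LogLink L X Y) (e : S.toD.obj X ≅ S.toD.obj Y) :
    e ∈ ℓ.inducedD ↔ ∃ φ ∈ ℓ.polyIso, (L.logDIso X).symm ≪≫ S.toD.mapIso φ = e := by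
  simp [inducedD]

/-- **IUTchIII:Prop1.2(i)** (kurims p.31) **Prop 1.2 (i) for the full log-link**: the induced poly-isomorphism `†D ⥲ ‡D` is the FULL
poly-isomorphism (every isomorphism of `D`-prime-strips lifts, [IUTchI] Cor 5.3 (ii)). [claim: Mochizuki2012, status: disputed] -/
theorem inducedD_full (L : LogStripData S) (X Y : S.F) : (full L X Y).inducedD = PolyIso.full _ _ := by
  ext e
  simp only [mem_inducedD, full, PolyIso.mem_full, true_and, iff_true]
  refine ⟨S.liftIso (L.logDIso X ≪≫ e), ?_⟩
  rw [S.mapIso_liftIso, ← Iso.trans_assoc, Iso.symm_self_id, Iso.refl_trans]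

/-- **IUTchIII:Rmk1.1.2(i)** (kurims p.29) **Rmk 1.1.2 (i)**: the tautological log-link induces exactly the tautological identification
`†D ⥲ D(log †F)` (a single, specific isomorphism — the "specific rigidifying path"), whereas the full
log-link induces the full ("tautologically indeterminate") poly-isomorphism (`inducedD_full`). [claim: Mochizuki2012, status: disputed] -/
theorem inducedD_tautological (L : LogStripData S) (X : S.F) :
    (tautological L X).inducedD = PolyIso.single (L.logDIso X).symm := by
  ext e
  simp only [mem_inducedD, tautological, PolyIso.single, Set.mem_singleton_iff, exists_eq_left,
    Functor.mapIso_refl, Iso.trans_refl]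
  exact eq_comm

/-- **IUTchIII:Prop1.2(i)** (kurims p.31) **Prop 1.2 (i), `D^⊢` part**: the induced poly-isomorphism `†D^⊢ ⥲ ‡D^⊢` of associated
`D^⊢`-prime-strips (push `inducedD` along `D ↦ D^⊢`). [claim: Mochizuki2012, status: disputed] -/
def inducedDv (ℓ : LogLink L X Y) : PolyIso (S.toDv.obj X) (S.toDv.obj Y) :=
  ℓ.inducedD.map S.DToDv

/-- **IUTchIII:Prop1.2(i)** (kurims p.31) The induced `D^⊢`-poly-isomorphism is nonempty. [claim: Mochizuki2012, status: disputed] -/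
theorem inducedDv_nonempty (ℓ : LogLink L X Y) : ℓ.inducedDv.Nonempty :=
  ℓ.inducedD_nonempty.image _

/-- **IUTchIII:Prop1.2(i)** (kurims p.31) For the full log-link the induced `D^⊢`-poly-isomorphism is the image of the full poly-isomorphism
`†D ⥲ ‡D` under `D ↦ D^⊢` (it is the full one as soon as `D ↦ D^⊢` is full on isomorphisms). [claim: Mochizuki2012, status: disputed] -/
theorem inducedDv_full (L : LogStripData S) (X Y : S.F) :
    (full L X Y).inducedDv = (PolyIso.full (S.toD.obj X) (S.toD.obj Y)).map S.DToDv := by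
  rw [inducedDv, inducedD_full]

/-- **IUTchIII:Prop1.2(i)** (kurims p.31) Prop 1.2 (i), last clause: the induced `D`-poly-isomorphism induces a poly-isomorphism
`Ψ_cns(†D) ⥲ Ψ_cns(‡D)` along ANY functorial algorithm `Ψ_cns` in the `D`-prime-strip [IUTchII,
Cor 4.5 (i)] — typed for an arbitrary functor `Ψ` out of the category of `D`-prime-strips. [claim: Mochizuki2012, status: disputed] -/
def inducedAlong (ℓ : LogLink L X Y) {E : Type*} [Category E] (Ψ : S.D ⥤ E) :
    PolyIso (Ψ.obj (S.toD.obj X)) (Ψ.obj (S.toD.obj Y)) :=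
  ℓ.inducedD.map Ψ

/-- **IUTchIII:Prop1.2(i)** (kurims p.31) … and for the full log-link along a functor this is the image of the full poly-isomorphism. [claim: Mochizuki2012, status: disputed] -/
theorem inducedAlong_full (L : LogStripData S) (X Y : S.F) {E : Type*} [Category E] (Ψ : S.D ⥤ E) :
    (full L X Y).inducedAlong Ψ = (PolyIso.full _ _).map Ψ := by
  rw [inducedAlong, inducedD_full]

end LogLink

/-! ### Prop 1.2 (x): the Frobenius-picture (infinite chain of full log-links) -/

/-- **IUTchIII:Prop1.2(x)** (kurims p.34) **Prop 1.2 (x), data**: "a collection of distinct `F`-prime-strips [relative to the given initial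
Θ-data] indexed by the integers" `{ⁿF}_{n∈ℤ}`. [claim: Mochizuki2012, status: disputed] -/
structure FrobeniusChain (S : StripFrame.{u}) where
  /-- `n ↦ ⁿF` -/
  F : ℤ → S.F
  /-- "distinct" -/
  injective : Function.Injective F

namespace FrobeniusChain

variable (L : LogStripData S) (P : FrobeniusChain S)

/-- **IUTchIII:Prop1.2(x)** (kurims p.34) "the full log-links `ⁿF --log--> ⁽ⁿ⁺¹⁾F`, for `n ∈ ℤ`" — the `n`-th horizontal arrow `• → •` of `Γ⃗`
(arrow `spoke n → spoke (n+1)` of `frobeniusPicture`). [claim: Mochizuki2012, status: disputed] -/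
def link (n : ℤ) : LogLink L (P.F n) (P.F (n + 1)) := LogLink.full L _ _

/-- **IUTchIII:Prop1.2(x)** (kurims p.34) Every arrow of the chain is a full log-link. [claim: Mochizuki2012, status: disputed] -/
theorem link_isFull (n : ℤ) : (P.link L n).IsFull := rfl

/-- **IUTchIII:Prop1.2(x)** (kurims p.34) **Prop 1.2 (x)**: the chain "induces chains of full poly-isomorphisms `… ⥲ ⁿD ⥲ ⁿ⁺¹D ⥲ …`" on the
associated `D`-prime-strips. [claim: Mochizuki2012, status: disputed] -/
theorem inducedD_link_full (n : ℤ) : (P.link L n).inducedD = PolyIso.full _ _ :=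
  LogLink.inducedD_full L _ _

/-- **IUTchIII:Prop1.2(x)** (kurims p.34) … "and `… ⥲ ⁿD^⊢ ⥲ ⁿ⁺¹D^⊢ ⥲ …`" on the associated `D^⊢`-prime-strips. [claim: Mochizuki2012, status: disputed] -/
theorem inducedDv_link_full (n : ℤ) :
    (P.link L n).inducedDv = (PolyIso.full (S.toD.obj (P.F n)) (S.toD.obj (P.F (n + 1)))).map S.DToDv :=
  LogLink.inducedDv_full L _ _

/-- **IUTchIII:Prop1.2(x)** (kurims p.34) The composite of consecutive induced `D`-poly-isomorphisms `ⁿD ⥲ ⁿ⁺¹D ⥲ ⁿ⁺²D` is again the full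
poly-isomorphism: along the chain the `D`-prime-strips are related by full poly-isomorphisms only —
"the "◦" corresponds to the "ⁿD", identified up to isomorphism" (the CORE of `Γ⃗`). [claim: Mochizuki2012, status: disputed] -/
theorem inducedD_comp_full (n : ℤ) :
    ((P.link L n).inducedD).comp ((P.link L (n + 1)).inducedD) = PolyIso.full _ _ := by
  rw [inducedD_link_full, inducedD_link_full]
  exact PolyIso.full_comp_of_nonempty ⟨_, PolyIso.mem_full (S.toD.mapIso (S.iso_nonempty_F _ _).some)⟩

/-- **IUTchIII:Prop1.2(x)** (kurims p.34) The core `◦`: all the `ⁿD` are mutually isomorphic `D`-prime-strips ("identified up to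
isomorphism"). [claim: Mochizuki2012, status: disputed] -/
theorem core_nonempty_iso (n m : ℤ) : Nonempty (S.toD.obj (P.F n) ≅ S.toD.obj (P.F m)) :=
  ⟨S.toD.mapIso (S.iso_nonempty_F _ _).some⟩

end FrobeniusChain

end Literature.IUT.LogThetaLattice
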